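import Summits.BirchSwinnertonDyer.Rank1Residual.X11b.RouteR1HalvesPointwise
import Literature.NumberTheory.EllipticCurves.AnticyclotomicRankinSelbergPAdicLFunction
import Literature.NumberTheory.LFunctions.DworkRationalityBorelDwork
import HarnessLib

/-!
# X11b, route R1 — the halves over the WIDE receptacle `𝓞_{ℂ_p}⟦T⟧` (every `p`): the kernel
# inference to `BSD_p` never used `R₀`-rationality of the BDP frame

HONEST FRAMING (cell `b2b-bsdres`, run/shared/lean/b2b/bsd-rank1-residual/, verbatim in every
file): the goal of the cell is to DELETE the COMBINATION-SHAPED residual classes of the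
Birch–Swinnerton-Dyer formula for ALL analytic-rank `≤ 1` elliptic curves over `ℚ` — "full BSD
formula for every rank `≤ 1` curve in class `C`" assembled STRICTLY from published theorems — so
that the rank-`≤ 1` remainder becomes exactly the CONSTRUCTION-SHAPED classes, which are TYPED
(missing-input `Prop`s), NOT attempted. This is not "finishing BSD". Sub-cell
`b2b-bsdres-multr1-p1` (X11b, route R1, gen 23); a RESEARCH ROUTE; no claim beyond the stated
class; X11b stays CONSTRUCTION-SHAPED; nothing here changes a label; no named fact; definitions with
bodies (`Prop`-valued SHAPES and two structure maps) and theorems; no `sorry`; every result using an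
OPEN shape is CONDITIONAL. Namespace/shape treaty with team x11b3 (OWNERS A6.3 (2)): `X11b.R1.` names,
`p` arbitrary but consumed by this seat only at `p ≥ 5`; no `Three.…` declaration is imported or
restated.

## Why this file (x11b3-lead R7-61, 2026-08-21T09:56Z, CROSS-LANE NOTICE to the A206 consumers)

x11b3-lit1's L59 flags, at PRINT level, that Castella 2018's proof of Thm. 3.1 ("`Tw_{ψ⁻¹} : Λ_{R₀} →
Λ_{R₀}`", arXiv:1704.06608 p. 9 ll. 42–47) and Castella–Hsieh 2018's receptacle need the values of
the auxiliary character `ψ̂` to lie in `R₀ = 𝓞(\widehat{ℚ_p^ur})`, which FAILS for fields `K` with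
`k(K,p) ≥ 1` (`p^k = |Cl_K / im G_tors|`); there "`L_p(f) ∈ Λ_{R₀}`" rests on an unwritten descent
from a ramified coefficient ring `𝒲 ⊋ R₀`. Statement as printed stands; referee's call; no mark.
Route R1's typed open input (gen 22, `R1.IMCEqFrameOnTree`: per datum a frame `L ∈ R₀⟦T⟧`) and the
registered facts A206/A222 carry `R₀` in their TYPE.

THIS FILE shows that `R₀` was never load-bearing for the kernel inference: the two pointwise
shapes and the algebra of equality are re-typed and re-proved over Hsieh's receptacle
`Λ = Z̄_p⟦Γ⁻⟧ ⊆ 𝓞_{ℂ_p}⟦T⟧` (tree: `PowerSeries 𝓞_ℂ_[p]`, values through `IntSeries.HasValueAt`, the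
currency of the landed fact `hsieh2014_exists_anticyclotomicPAdicLFunction`, x11b3 S18(a)), and the
`R₀`-typed shapes of gen 20 map into them along `R₀ ⊆ 𝓞_{ℂ_p}` (`unrIntegers_le_padicComplexInt`).
`BSD_p` reads only `ord_p` of a constant term in `ℂ_p`; units of `𝓞_{ℂ_p}⟦T⟧` have constant term
of norm `1` exactly as units of `R₀⟦T⟧` do.

* §1 receptacle `𝓞_{ℂ_p}`: `‖x‖ ≤ 1` on `𝓞_{ℂ_p}` (the tree's bridge `Dwork.mem_unitBall`), units of norm `1`, the structure maps
  `R1.toCpInt : ℤ_p → 𝓞_{ℂ_p}` and `R1.unrToCpInt : R₀ → 𝓞_{ℂ_p}` (compatible with x11b3's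
  `Halves.toUnr`), value of `Q ∈ 𝓞_{ℂ_p}⟦T⟧` at `T = 0` = constant term, values of `L ∈ R₀⟦T⟧` unchanged
  when read in `𝓞_{ℂ_p}⟦T⟧`.
* §2 the ALGEBRA OF EQUALITY over `𝓞_{ℂ_p}⟦T⟧` (`R1.valuation_constantCoeff_eq_of_span_map_eq_int`):
  `f ∈ Λ`, `f(0) ≠ 0`, `(f)·𝓞_{ℂ_p}⟦T⟧ = (Q)`, `Q(0) = u·((1 − a/p)x)²`, `‖u‖ = 1`, `p ∤ a` ⟹ `x ≠ 0`
  and `ord_p f(0) = 2(ord_p x − 1)` EXACTLY — verbatim gen 20's norm argument.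
* §3 the shapes over `𝓞_{ℂ_p}⟦T⟧`: **`R1.IsBDPLFunctionInt`** (Castella's interpolation property,
  VERBATIM the Literature predicate `IsBDPLFunction` with the receptacle widened — a predicate with
  parameters, nothing asserted), **`R1.BDPValueAtOneIntAt`** (H2♭: `Q(𝟙) = u·((1 − a_p p⁻¹)·log_ω P)²`,
  `‖u‖ = 1`), **`R1.IMCEqIntAt`** (H3♭: `Ch_Λ(X_ac)·𝓞_{ℂ_p}⟦T⟧ = (Q)`, OPEN shape); the maps
  `R₀ → 𝓞_{ℂ_p}` on all three (`…_map`); and **`R1.imcWaldspurgerOnTreeAt_of_intHalves`**: CTL₀ ∧ H3♭ ∧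
  H2♭ ⟹ the composite `IMCWaldspurgerOnTreeAt` with the SAME `n`.

So a refereed statement about Castella's `L_p(f)` typed over ANY coefficient ring inside `𝓞_{ℂ_p}`
(`R₀`, a finite extension `𝒲`, `Z̄_p`, `𝓞_{ℂ_p}`) feeds the route; the class-level frame form over
`𝓞_{ℂ_p}⟦T⟧` is the companion file `RouteR1IntFrame.lean`. CONDITIONAL wherever H3♭ enters; X11b stays
CONSTRUCTION-SHAPED; no label change.

References: [Castella2018] Thm. 3.1, Thm. 3.2, §5 (arXiv:1704.06608 pp. 9, 12); [Castella2018Erratum]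
Thm. 1.1 (p. 1); [Hsieh2014] M.-L. Hsieh, Doc. Math. 19 (2014), Thm. 1 and p. 7 (`Λ = Z̄_p⟦Γ⁻⟧`);
[CastellaHsieh2018] §3.3.
-/

noncomputable section

open scoped Classical

open WeierstrassCurve NumberField IsDedekindDomain Field PowerSeries
open Literature.NumberTheory.EllipticCurves
open Literature.NumberTheory.EllipticCurves.ModularForms
open Literature.NumberTheory.EllipticCurves.Rank1Residual
open Literature.NumberTheory.GaloisRepresentations
open Summit.BirchSwinnertonDyer.Rank1Residual.X11b.AcSelmer
open Summit.BirchSwinnertonDyer.Rank1Residual.X11b.CongruenceLimit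
open Summit.BirchSwinnertonDyer.Rank1Residual.X11b.Halves

namespace Summit.BirchSwinnertonDyer.Rank1Residual.X11b

/-! ### §1 The receptacle `𝓞_{ℂ_p} ⊇ R₀ ⊇ ℤ_p` (every prime `p`) -/

section Receptacle

variable (p : ℕ) [Fact p.Prime]

/-- Elements of Mathlib's `𝓞_ℂ_[p]` (the valuation subring of `ℂ_p`; Hsieh 2014, p. 7: `Z̄_p ⊆
𝓞_{ℂ_p}`) have norm `≤ 1` — the tree's bridge `Dwork.mem_unitBall` between the valuation-theoretic
definition and the norm. [cite: Hsieh2014, p. 7 (arXiv:1112.1580)] -/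
theorem R1.norm_coe_padicComplexInt_le_one (x : 𝓞_ℂ_[p]) : ‖(x : ℂ_[p])‖ ≤ 1 :=
  Literature.NumberTheory.LFunctions.Dwork.mem_unitBall.mp x.2

/-- Units of `𝓞_{ℂ_p}` have norm exactly `1` (`‖u‖·‖u⁻¹‖ = 1`, both `≤ 1`). [folklore] -/
theorem R1.norm_coe_units_padicComplexInt (u : (𝓞_ℂ_[p])ˣ) :
    ‖((u : 𝓞_ℂ_[p]) : ℂ_[p])‖ = 1 := by
  refine le_antisymm (R1.norm_coe_padicComplexInt_le_one p _) ?_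
  have h1 : ‖((u : 𝓞_ℂ_[p]) : ℂ_[p])‖ *
      ‖(((u⁻¹ : (𝓞_ℂ_[p])ˣ) : 𝓞_ℂ_[p]) : ℂ_[p])‖ = 1 := by
    rw [← norm_mul, ← MulMemClass.coe_mul, Units.mul_inv, OneMemClass.coe_one, norm_one]
  calc (1 : ℝ) = ‖((u : 𝓞_ℂ_[p]) : ℂ_[p])‖ *
        ‖(((u⁻¹ : (𝓞_ℂ_[p])ˣ) : 𝓞_ℂ_[p]) : ℂ_[p])‖ := h1.symm
    _ ≤ ‖((u : 𝓞_ℂ_[p]) : ℂ_[p])‖ * 1 :=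
        mul_le_mul_of_nonneg_left (R1.norm_coe_padicComplexInt_le_one p _) (norm_nonneg _)
    _ = ‖((u : 𝓞_ℂ_[p]) : ℂ_[p])‖ := mul_one _

/-- `ℤ_p ⊆ 𝓞_{ℂ_p}` inside `ℂ_p` (`‖x‖ ≤ 1` is preserved by `ℚ_p → ℂ_p`). [folklore] -/
theorem R1.algebraMap_coe_padicInt_mem_padicComplexInt (x : ℤ_[p]) :
    algebraMap ℚ_[p] ℂ_[p] (x : ℚ_[p]) ∈ 𝓞_ℂ_[p] :=
  Literature.NumberTheory.LFunctions.Dwork.mem_unitBall.mpr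
    (by rw [norm_algebraMap']; exact PadicInt.norm_le_one x)

/-- **The structure map `ℤ_p → 𝓞_{ℂ_p}`** (`Λ = ℤ_p⟦T⟧ → 𝓞_{ℂ_p}⟦T⟧` on coefficients; Hsieh's
`Z̄_p⟦Γ⁻⟧` sits in between). [cite: Hsieh2014, p. 7 (arXiv:1112.1580)] -/
def R1.toCpInt : ℤ_[p] →+* 𝓞_ℂ_[p] :=
  ((algebraMap ℚ_[p] ℂ_[p]).comp PadicInt.Coe.ringHom).codRestrict (𝓞_ℂ_[p])
    (R1.algebraMap_coe_padicInt_mem_padicComplexInt p)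

/-- `R1.toCpInt p x`, seen in `ℂ_p`, is the image of `x` under `ℤ_p ⊂ ℚ_p → ℂ_p`. [folklore] -/
@[simp]
theorem R1.coe_toCpInt (x : ℤ_[p]) :
    ((R1.toCpInt p x : 𝓞_ℂ_[p]) : ℂ_[p]) = algebraMap ℚ_[p] ℂ_[p] (x : ℚ_[p]) :=
  rfl

/-- **The inclusion `R₀ → 𝓞_{ℂ_p}`** as a ring map (`unrIntegers_le_padicComplexInt`, x11b3 S18(a)):
`Λ_{R₀} = R₀⟦T⟧ → 𝓞_{ℂ_p}⟦T⟧` on coefficients. [cite: Castella2018, §3 (arXiv:1704.06608 p. 9)] -/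
def R1.unrToCpInt : unrIntegers p →+* 𝓞_ℂ_[p] :=
  (unrIntegers p).subtype.codRestrict (𝓞_ℂ_[p])
    (fun x ↦ unrIntegers_le_padicComplexInt x.2)

/-- `R1.unrToCpInt p x`, seen in `ℂ_p`, is `x`. [folklore] -/
@[simp]
theorem R1.coe_unrToCpInt (x : unrIntegers p) :
    ((R1.unrToCpInt p x : 𝓞_ℂ_[p]) : ℂ_[p]) = (x : ℂ_[p]) :=
  rfl

/-- Compatibility of the structure maps: `R₀ → 𝓞_{ℂ_p}` after x11b3's `Halves.toUnr : ℤ_p → R₀` is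
`R1.toCpInt`. [folklore] -/
theorem R1.unrToCpInt_comp_toUnr : (R1.unrToCpInt p).comp (toUnr p) = R1.toCpInt p := by
  refine RingHom.ext fun x ↦ Subtype.ext ?_
  rfl

/-- On power series: the map along `ℤ_p → 𝓞_{ℂ_p}` is the composite of the maps along
`ℤ_p → R₀` and `R₀ → 𝓞_{ℂ_p}` (`PowerSeries.map_comp`). [folklore] -/
theorem R1.map_toCpInt_eq_comp :
    (PowerSeries.map (R1.toCpInt p) : IwasawaAlgebra p →+* PowerSeries 𝓞_ℂ_[p]) =
      (PowerSeries.map (R1.unrToCpInt p)).comp (PowerSeries.map (toUnr p)) := by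
  rw [← PowerSeries.map_comp, R1.unrToCpInt_comp_toUnr]

/-- On power series: mapping along `ℤ_p → R₀ → 𝓞_{ℂ_p}` is mapping along `ℤ_p → 𝓞_{ℂ_p}`. [folklore] -/
theorem R1.map_unrToCpInt_map_toUnr (f : IwasawaAlgebra p) :
    PowerSeries.map (R1.unrToCpInt p) (PowerSeries.map (toUnr p) f) =
      PowerSeries.map (R1.toCpInt p) f := by
  rw [R1.map_toCpInt_eq_comp, RingHom.comp_apply]

/-- **The value at the trivial character is the constant term** over the wide receptacle:
`Q(𝟙) = Q(T = 0) = [T⁰]Q`. [cite: Hsieh2014, Thm. 1 (arXiv:1112.1580 p. 4)] -/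
theorem R1.intSeries_hasValueAt_zero (Q : PowerSeries 𝓞_ℂ_[p]) :
    IntSeries.HasValueAt Q 0 ((PowerSeries.constantCoeff Q : 𝓞_ℂ_[p]) : ℂ_[p]) := by
  have h := hasSum_single (f := fun k : ℕ ↦
    ((PowerSeries.coeff k Q : 𝓞_ℂ_[p]) : ℂ_[p]) * (0 : ℂ_[p]) ^ k) 0
    (fun k hk ↦ by rw [zero_pow hk, mul_zero])
  simpa [IntSeries.HasValueAt] using h

/-- Any `v` with `IntSeries.HasValueAt Q 0 v` is the constant term `Q(0)`. [folklore] -/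
theorem R1.intSeries_eq_constantCoeff_of_hasValueAt_zero {Q : PowerSeries 𝓞_ℂ_[p]} {v : ℂ_[p]}
    (h : IntSeries.HasValueAt Q 0 v) :
    v = ((PowerSeries.constantCoeff Q : 𝓞_ℂ_[p]) : ℂ_[p]) :=
  h.unique (R1.intSeries_hasValueAt_zero p Q)

/-- **An `R₀⟦T⟧`-valued element read in `𝓞_{ℂ_p}⟦T⟧` has the same values** (same coefficients in
`ℂ_p`; `IntSeries.hasValueAt_iff_of_coeff_eq`). [cite: Castella2018, §2.2 (arXiv:1704.06608 p. 5)] -/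
theorem R1.intSeries_hasValueAt_map_iff (L : UnrSeries p) (x v : ℂ_[p]) :
    IntSeries.HasValueAt (PowerSeries.map (R1.unrToCpInt p) L) x v ↔ L.HasValueAt x v :=
  IntSeries.hasValueAt_iff_of_coeff_eq (fun k ↦ by rw [PowerSeries.coeff_map]; rfl) x v

end Receptacle

/-! ### §2 The algebra of EQUALITY over `𝓞_{ℂ_p}⟦T⟧` (every prime `p`) -/

section Algebra

variable (p : ℕ) [Fact p.Prime]

/-- **The algebra of EQUALITY over the wide receptacle.** If `f ∈ Λ = ℤ_p⟦T⟧` has non-zero constant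
term, its image in `𝓞_{ℂ_p}⟦T⟧` GENERATES the same ideal as `Q` — `(f)·𝓞_{ℂ_p}⟦T⟧ = (Q)` — and
`Q(0) = u·((1 − a p⁻¹)·x)²` with `‖u‖ = 1` and `p ∤ a`, then `x ≠ 0` and `ord_p f(0) = 2·(ord_p x − 1)`
EXACTLY. Proof by norms in `ℂ_p`, verbatim gen 20's `R1.valuation_constantCoeff_eq_of_span_map_eq`
with `R₀` replaced by `𝓞_{ℂ_p}`: `f ↦ v·Q` with `v` a UNIT of the domain `𝓞_{ℂ_p}⟦T⟧`, whose constant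
term is a unit of `𝓞_{ℂ_p}`, of norm `1`; so `‖f(0)‖ = ‖Q(0)‖ = ‖1 − a/p‖²‖x‖² = p²‖x‖²`. No
noetherianity of the receptacle is used. [folklore] -/
theorem R1.valuation_constantCoeff_eq_of_span_map_eq_int {f : IwasawaAlgebra p}
    (hf0 : constantCoeff f ≠ 0) {Q : PowerSeries 𝓞_ℂ_[p]}
    (hfQ : Ideal.span {PowerSeries.map (R1.toCpInt p) f} =
      Ideal.span ({Q} : Set (PowerSeries 𝓞_ℂ_[p])))
    {u : ℂ_[p]} (hu : ‖u‖ = 1) {a : ℤ} (ha : ¬ (p : ℤ) ∣ a) {x : ℚ_[p]}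
    (hQ : IntSeries.HasValueAt Q 0 (u *
      (algebraMap ℚ_[p] ℂ_[p] (((1 : ℚ_[p]) - (a : ℚ_[p]) * (p : ℚ_[p])⁻¹) * x)) ^ 2)) :
    x ≠ 0 ∧ ((constantCoeff f).valuation : ℤ) = 2 * (x.valuation - 1) := by
  set y : ℚ_[p] := ((1 : ℚ_[p]) - (a : ℚ_[p]) * (p : ℚ_[p])⁻¹) * x with hy
  -- `Q(0)` is the constant term
  have hQ0 : u * (algebraMap ℚ_[p] ℂ_[p] y) ^ 2 =
      ((constantCoeff Q : 𝓞_ℂ_[p]) : ℂ_[p]) :=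
    R1.intSeries_eq_constantCoeff_of_hasValueAt_zero p hQ
  -- `map toCpInt f = Q · v` with `v` a unit
  obtain ⟨v, hv⟩ := Ideal.span_singleton_eq_span_singleton.mp hfQ.symm
  have hv0 : ‖((constantCoeff (v : PowerSeries 𝓞_ℂ_[p]) : 𝓞_ℂ_[p]) : ℂ_[p])‖ = 1 := by
    obtain ⟨w, hw⟩ := PowerSeries.isUnit_constantCoeff (v : PowerSeries 𝓞_ℂ_[p]) v.isUnit
    rw [← hw]
    exact R1.norm_coe_units_padicComplexInt p w
  have hfac : algebraMap ℚ_[p] ℂ_[p] ((constantCoeff f : ℤ_[p]) : ℚ_[p]) =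
      ((constantCoeff Q : 𝓞_ℂ_[p]) : ℂ_[p]) *
        ((constantCoeff (v : PowerSeries 𝓞_ℂ_[p]) : 𝓞_ℂ_[p]) : ℂ_[p]) := by
    rw [← R1.coe_toCpInt, ← constantCoeff_map_apply (R1.toCpInt p) f, ← hv, map_mul,
      MulMemClass.coe_mul]
  -- norms
  have hp1 : (1 : ℝ) < p := by exact_mod_cast (Fact.out : p.Prime).one_lt
  have hp0 : (0 : ℝ) < p := by positivity
  have hnormf : ‖((constantCoeff f : ℤ_[p]) : ℚ_[p])‖ = (p : ℝ) ^ 2 * ‖x‖ ^ 2 := by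
    calc ‖((constantCoeff f : ℤ_[p]) : ℚ_[p])‖
        = ‖algebraMap ℚ_[p] ℂ_[p] ((constantCoeff f : ℤ_[p]) : ℚ_[p])‖ :=
          (norm_algebraMap' ℂ_[p] _).symm
      _ = ‖((constantCoeff Q : 𝓞_ℂ_[p]) : ℂ_[p])‖ := by rw [hfac, norm_mul, hv0, mul_one]
      _ = ‖algebraMap ℚ_[p] ℂ_[p] y‖ ^ 2 := by
          rw [← hQ0, norm_mul, norm_pow, hu, one_mul]
      _ = ‖y‖ ^ 2 := by rw [norm_algebraMap']
      _ = ((p : ℝ) * ‖x‖) ^ 2 := by rw [hy, norm_mul, R1.norm_one_sub_div_eq p ha]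
      _ = (p : ℝ) ^ 2 * ‖x‖ ^ 2 := by ring
  -- `x ≠ 0`
  have hx0 : x ≠ 0 := by
    intro hx
    rw [hx, norm_zero, zero_pow two_ne_zero, mul_zero] at hnormf
    exact hf0 (PadicInt.coe_eq_zero.mp (norm_eq_zero.mp hnormf))
  refine ⟨hx0, R1.eq_two_mul_sub_one_of_zpow_eq p ?_⟩
  rwa [← PadicInt.norm_def, PadicInt.norm_eq_zpow_neg_valuation hf0,
    Padic.norm_eq_zpow_neg_valuation hx0] at hnormf

end Algebra

/-! ### §3 The shapes over `𝓞_{ℂ_p}⟦T⟧` and the maps from the `R₀`-shapes (every `p`) -/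

section Interpolation

variable (p : ℕ) [Fact p.Prime] {K : Type} [Field K] [NumberField K] {N : ℕ}

/-- **Castella's interpolation property over the wide receptacle** — VERBATIM the Literature
predicate `IsBDPLFunction ι 𝔭 κ γ f Ω_K Ω_p` (Castella 2018, Thm. 3.1: at every everywhere-unramified
Hecke character `φ` of infinity type `(-n, n)`, `n > 0`, and every `p`-adic avatar `r` of `φ`
factoring through `Γ`, the value at `T = φ̂(γ) − 1` is `ι⁻¹(bdpInterpolationValue …)·Ω_p^{4n}`) with
`L ∈ R₀⟦T⟧` replaced by `Q ∈ 𝓞_{ℂ_p}⟦T⟧` and `UnrSeries.HasValueAt` by `IntSeries.HasValueAt` (the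
currency of `IsHsiehLFunction`). A characterising PREDICATE with parameters; nothing asserted; it is
implied by `IsBDPLFunction` along `R₀ ⊆ 𝓞_{ℂ_p}` (`R1.isBDPLFunctionInt_map`) and is the shape in which a
statement about `L_p(f)` over ANY coefficient ring inside `𝓞_{ℂ_p}` can be read.
[cite: Castella2018, Thm. 3.1 (arXiv:1704.06608 p. 9) (shape only; nothing asserted)]
[cite: Hsieh2014, Thm. 1 and p. 7 (arXiv:1112.1580) (the receptacle `Z̄_p⟦Γ⁻⟧ ⊆ 𝓞_{ℂ_p}⟦T⟧`)] -/
def R1.IsBDPLFunctionInt (ι : PadicAlgCl p ≃+* ℂ) (𝔭 : HeightOneSpectrum (𝓞 K)) (κ : ZpExtension K p)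
    (γ : Field.absoluteGaloisGroup K) (f : CuspForm (CongruenceSubgroup.Gamma0 N) 2) (ΩK : ℂ)
    (Ωp : ℂ_[p]) (Q : PowerSeries 𝓞_ℂ_[p]) : Prop :=
  ∀ (φ : HeckeCharacter K) (n : ℕ), 0 < n → (∀ v : HeightOneSpectrum (𝓞 K), φ.IsUnramifiedAt v) →
    φ.HasInfinityType (fun _ ↦ (n : ℤ)) (fun _ ↦ -(n : ℤ)) →
    ∀ r : FramedGaloisRep K (PadicAlgCl p) 1, IsPAdicAvatarOf ι φ r → FactorsThroughZp κ r →
      IntSeries.HasValueAt Q (avatarValueAt r γ - 1)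
        (((ι.symm (bdpInterpolationValue p f 𝔭 φ n ΩK) : PadicAlgCl p) : ℂ_[p]) * Ωp ^ (4 * n))

variable {p}

/-- **`R₀`-frame ⟹ `𝓞_{ℂ_p}`-frame**: an `L ∈ R₀⟦T⟧` with Castella's interpolation property, read in
`𝓞_{ℂ_p}⟦T⟧`, has it there (same values). [cite: Castella2018, Thm. 3.1 (arXiv:1704.06608 p. 9)] -/
theorem R1.isBDPLFunctionInt_map {ι : PadicAlgCl p ≃+* ℂ} {𝔭 : HeightOneSpectrum (𝓞 K)}
    {κ : ZpExtension K p} {γ : Field.absoluteGaloisGroup K}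
    {f : CuspForm (CongruenceSubgroup.Gamma0 N) 2} {ΩK : ℂ} {Ωp : ℂ_[p]} {L : UnrSeries p}
    (hL : IsBDPLFunction ι 𝔭 κ γ f ΩK Ωp L) :
    R1.IsBDPLFunctionInt p ι 𝔭 κ γ f ΩK Ωp (PowerSeries.map (R1.unrToCpInt p) L) :=
  fun φ n hn hunr hinf r hr hκ ↦
    (R1.intSeries_hasValueAt_map_iff p L _ _).mpr (hL φ n hn hunr hinf r hr hκ)

end Interpolation

section Pointwise

variable {K : Type} [Field K] [NumberField K] (W : WeierstrassCurve ℚ) [W.IsElliptic]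
  [W.IsGloballyMinimal] (p : ℕ) [Fact p.Prime] (ι : K →+* ℚ_[p])
  (P : (W.baseChange K).toAffine.Point)

variable (κ : ZpExtension K p) (𝔭 : HeightOneSpectrum (𝓞 K)) (γ : Field.absoluteGaloisGroup K)
  [Fact (κ.IsTopGenerator γ)]

/-- **H2♭ — (BDP) at `𝟙` over the wide receptacle**, Cas18 Thm. 3.2 SHAPE at `Q ∈ 𝓞_{ℂ_p}⟦T⟧`: the
value of `Q` at the trivial character (`T = 0`) is `u·((1 − a·p⁻¹)·log_{ω_E} P)²` for some `u ∈ ℂ_p`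
of norm `1` ("up to a `p`-adic unit"), with `a` meant to be `a_p(E)` and `Q` meant to be Castella's
`L_p(f)` read in `𝓞_{ℂ_p}⟦T⟧`. A predicate; nothing asserted; PUB shape (printed proof at `p ∣ N`:
[cas-split] Thm. 2.11, split `p ≥ 5`).
[cite: Castella2018, Thm. 3.2 (arXiv:1704.06608 p. 9) (shape only; nothing asserted)] -/
def R1.BDPValueAtOneIntAt (Q : PowerSeries 𝓞_ℂ_[p]) (a : ℤ) : Prop :=
  ∃ u : ℂ_[p], ‖u‖ = 1 ∧ IntSeries.HasValueAt Q 0 (u *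
    (algebraMap ℚ_[p] ℂ_[p] (((1 : ℚ_[p]) - (a : ℚ_[p]) * (p : ℚ_[p])⁻¹) * logOmega W p ι P)) ^ 2)

/-- **H3♭ — (IMC) over the wide receptacle**, erratum Thm. 1.1 SHAPE at `Q ∈ 𝓞_{ℂ_p}⟦T⟧`: the image
of `Ch_Λ(X_ac^∅(E[p^∞]))` under `Λ → 𝓞_{ℂ_p}⟦T⟧` generates `(Q)` (EQUALITY of principal ideals of the
domain `𝓞_{ℂ_p}⟦T⟧`; implied by the equality over any intermediate coefficient ring). THE OPEN statement
of route R1 for Castella's `L_p(f)` (UNREFEREED ⇐ [FW21, Thm. 4.41], PREPRINT). A predicate; NEVER a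
theorem here. [claim: Castella2018Erratum, status: under-review] -/
def R1.IMCEqIntAt (Q : PowerSeries 𝓞_ℂ_[p]) : Prop :=
  (XAc.charIdeal (W.baseChange K) p κ 𝔭 ∅ γ).map (PowerSeries.map (R1.toCpInt p)) =
    Ideal.span {Q}

variable {W p ι P κ 𝔭 γ}

/-- H2 (over `R₀⟦T⟧`, gen 20) ⟹ H2♭ for the same element read in `𝓞_{ℂ_p}⟦T⟧`. [folklore] -/
theorem R1.bdpValueAtOneIntAt_map {L : UnrSeries p} {a : ℤ}
    (h : R1.BDPValueAtOneOnTreeAt W p ι P L a) :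
    R1.BDPValueAtOneIntAt W p ι P (PowerSeries.map (R1.unrToCpInt p) L) a := by
  obtain ⟨u, hu⟩ := h
  exact ⟨((u : unrIntegers p) : ℂ_[p]), norm_coe_units_unrIntegers p u,
    (R1.intSeries_hasValueAt_map_iff p L _ _).mpr hu⟩

omit [W.IsElliptic] [W.IsGloballyMinimal] in
/-- H3 (over `R₀⟦T⟧`, gen 20) ⟹ H3♭ for the same element read in `𝓞_{ℂ_p}⟦T⟧` (`Ideal.map_map` along
`ℤ_p → R₀ → 𝓞_{ℂ_p}`). [claim: Castella2018Erratum, status: under-review] -/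
theorem R1.imcEqIntAt_map {L : UnrSeries p} (h : R1.IMCEqOnTreeAt W p κ 𝔭 γ L) :
    R1.IMCEqIntAt W p κ 𝔭 γ (PowerSeries.map (R1.unrToCpInt p) L) := by
  unfold R1.IMCEqIntAt
  rw [R1.IMCEqOnTreeAt] at h
  rw [R1.map_toCpInt_eq_comp, ← Ideal.map_map, h, Ideal.map_span, Set.image_singleton]

/-- **HALVES OVER THE WIDE RECEPTACLE ⟹ the composite, pointwise (every `p`).** CTL₀
(`HasCharValuationAt … n`) ∧ H3♭ (`Ch_Λ(X_ac)·𝓞_{ℂ_p}⟦T⟧ = (Q)`) ∧ H2♭ (`Q(𝟙) = u·((1 − a/p)·log_ω P)²`,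
`‖u‖ = 1`, `p ∤ a`) ⟹ route R1's composite open link `IMCWaldspurgerOnTreeAt p κ 𝔭 γ ι P` with the
SAME `n` (`= 2·(ord_p log_ω P − 1)`). No `R₀`-rationality anywhere.
[cite: Castella2018, §5 (5.1) (arXiv:1704.06608 p. 12)] [cite: Castella2018Erratum, Thm. 1.1 (p. 1)] -/
theorem R1.imcWaldspurgerOnTreeAt_of_intHalves {n : ℕ}
    (hn : XAc.HasCharValuationAt (W.baseChange K) p κ 𝔭 ∅ γ n) {Q : PowerSeries 𝓞_ℂ_[p]}
    (h3 : R1.IMCEqIntAt W p κ 𝔭 γ Q) {a : ℤ} (ha : ¬ (p : ℤ) ∣ a)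
    (h2 : R1.BDPValueAtOneIntAt W p ι P Q a) : IMCWaldspurgerOnTreeAt p κ 𝔭 γ ι P := by
  obtain ⟨htors, f, hf, hf0, hfn⟩ := hn
  obtain ⟨u, hu, hval⟩ := h2
  have hspan : Ideal.span {PowerSeries.map (R1.toCpInt p) f} =
      Ideal.span ({Q} : Set (PowerSeries 𝓞_ℂ_[p])) := by
    rw [R1.IMCEqIntAt, hf, Ideal.map_span, Set.image_singleton] at h3
    exact h3
  obtain ⟨hx0, hv⟩ := R1.valuation_constantCoeff_eq_of_span_map_eq_int p hf0 hspan hu ha hval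
  refine ⟨n, ⟨htors, f, hf, hf0, hfn⟩, ?_⟩
  rw [← valuation_logOmega hx0, ← hfn]
  exact hv

end Pointwise

end Summit.BirchSwinnertonDyer.Rank1Residual.X11b

end
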